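import Summits.HodgeConjecture.HodgeConjecture.Theses.DworkReflectionQuotients
import Literature.AlgebraicGeometry.HodgeTheory.DworkSexticEquivariantTransport

/-!
# Crux K2 `FlatClassesSpannedByReflectionInvariants` for the singleton flat type `(1,2,3,3,4,5)` —
# UNCONDITIONAL (no named fact, no hypothesis)

Route `route-HodgeConjecture-DworkReflectionQuotients` (cell `hodge-nonav`, rung F-H1 — never summit
credit), item `stmt-HodgeConjecture-20241`; landed `--supports stmt-HodgeConjecture-20241` (it serves the
item without closing it: it is the `j = 0` instance of the crux — Katz's rank-one type, 360 of the 1170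
flat classes). Prover seat `hodge-nonav-20241-p1` (g3), 2026-08-27.

The earlier file `DworkReflectionQuotientsK2SingletonOfTransport` (g2) proved this instance CONDITIONALLY on a
`Γ_W`-equivariant injective transport `T : H⁴(X_ψ(ℂ); ℂ) → H⁴(X⁴₆(ℂ); ℂ)`. That transport is now a theorem
of the tree (`Literature.AlgebraicGeometry.HodgeTheory.DworkSextic.exists_equivariant_transport`, file
`DworkSexticEquivariantTransport`: Ehresmann transport in the family of `Γ_W`-invariant nonsingular sextics
— the tree's monomial-supported family with its relative diagonal automorphisms `sigmaM` — along a path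
from `F_ψ` to the Fermat form in `ℂ ∖ μ₆`, Katz 2009 §3 / Voisin II §3.1.2), so the hypothesis is gone:
purity `(2,2)` of the singleton eigenlines follows from symmetry and rank one
(`DworkSexticSingletonPurity`), the rank from the transport (`DworkSexticSingletonRankOfTransport`), and
the crux body from the six-reflection averaging identity (`DworkSexticReflectionAveraging`). No use of
`Katz2009_dworkSexticEigenspaces` or `Griffiths1969_residues_span_hodgeFiltration`.

The three other flat types (`j = 1, 2, 3`) are not covered here: `j = 2, 3` are reduced in
`DworkSexticFlatPiecesPurityOfTransport` to the same transport plus the `Γ_W`-character of `H^{4,0}(X_ψ)`;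
`j = 1` still needs Griffiths' residue theorem at pole order two (`DworkReflectionQuotientsK2OfGriffiths`).

## References

* N. M. Katz, *Another look at the Dwork family*, Progr. Math. 270 (2009), §3, Lemma 3.1. [Katz2009]
* C. Voisin, *Hodge Theory and Complex Algebraic Geometry II* (2003), §3.1.2, §6.2.1. [VoisinHodgeII2003]
* G. Bini, A. Garbagnati, *Quotients of the Dwork pencil*, J. Geom. Phys. 75 (2014), §3.4.
  [BiniGarbagnati2012]
-/

namespace Summit.HodgeConjecture.HodgeConjecture.Theorems

open Literature.AlgebraicGeometry.HodgeTheory Literature.AlgebraicGeometry.Motives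
open Literature.AlgebraicTopology.SingularHomology

/-- **Crux K2 for the singleton type, unconditionally.** For `ψ⁶ ≠ 1`, `σ ∈ 𝔖₆` and every rational class
`w = u + v` with `u` an eigenclass of exponent `(1,2,3,3,4,5) ∘ σ` and `v` one of exponent
`(6 − (1,2,3,3,4,5)) ∘ σ` (the route's `IsEig`, `= DworkSextic.IsEig ψ`), the class `w` lies in the `ℂ`-span
of the rational `(2,2)`-classes fixed by a realised reflection `s_(i,i',ζ)` — the `j = 0` instance of
`FlatClassesSpannedByReflectionInvariants` (`X_ψ = DworkSextic.fibre ψ`, `pt = DworkSextic.pt ψ`,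
`(1,2,3,3,4,5) = DworkSextic.flatTypes 0`). One application of
`DworkSextic.flatClasses_mem_span_reflInvariant_singleton`; NO hypothesis, no named fact.
[cite: Katz2009, §3 and Lemma 3.1] [cite: VoisinHodgeII2003, §3.1.2] [cite: BiniGarbagnati2012, §3.4] -/
theorem flatClassesSpannedByReflectionInvariants_singleton
    {ψ : ℂ} (hψ : ψ ^ 6 ≠ 1) (σ : Equiv.Perm (Fin 6))
    (w : complexBetti (DworkSextic.fibre ψ) (2 * 2)) (hrat : IsRationalClass w)
    (huv : ∃ u v : complexBetti (DworkSextic.fibre ψ) (2 * 2),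
      DworkSextic.IsEig ψ (fun l => DworkSextic.flatTypes 0 (σ l)) u ∧
      DworkSextic.IsEig ψ (fun l => 6 - DworkSextic.flatTypes 0 (σ l)) v ∧ w = u + v) :
    w ∈ Submodule.span ℂ {c : complexBetti (DworkSextic.fibre ψ) (2 * 2) | IsRationalClass c ∧
      IsOfHodgeType 4 (DworkSextic.fibre ψ) (2 * 2) 2 2 c ∧ ∃ i i' : Fin 6, i ≠ i' ∧ ∃ ζ : ℂ, ζ ^ 6 = 1 ∧
        ∃ g : C(ComplexPoints (DworkSextic.fibre ψ), ComplexPoints (DworkSextic.fibre ψ)),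
          (∀ x, ∃ t : ℂ, (DworkSextic.pt ψ (g x)).rep = t • (fun k => if k = i then ζ * (DworkSextic.pt ψ x).rep i'
            else if k = i' then ζ⁻¹ * (DworkSextic.pt ψ x).rep i else (DworkSextic.pt ψ x).rep k)) ∧
          singularCohomology.map ℂ ℂ g (2 * 2) c = c} :=
  DworkSextic.flatClasses_mem_span_reflInvariant_singleton hψ σ w hrat huv

/-- The same, read against the ROUTE DECL's inline objects: the `j = 0` slice of
`FlatClassesSpannedByReflectionInvariants` (all binders of the route statement, with `j` fixed to `0`),
unconditionally. [cite: Katz2009, §3 and Lemma 3.1] [cite: BiniGarbagnati2012, §3.4] -/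
theorem flatClassesSpannedByReflectionInvariants_slice_zero :
    ∀ ψ : ℂ, ψ ^ 6 ≠ 1 → let F : MvPolynomial (Fin 6) ℂ := (∑ i, MvPolynomial.X i ^ 6) - MvPolynomial.C (6 * ψ) * ∏ i, MvPolynomial.X i; let X := Literature.AlgebraicGeometry.Motives.SmoothHypersurface.hypersurface F; let pt := Literature.AlgebraicGeometry.HodgeTheory.hypersurfacePoint (Literature.AlgebraicGeometry.Motives.SmoothHypersurface.hypersurfaceι F); let IsEig : (Fin 6 → ℕ) → Literature.AlgebraicGeometry.HodgeTheory.complexBetti X (2 * 2) → Prop := fun e c => ∀ a : Fin 6 → ℂ, (∀ i, a i ^ 6 = 1) → ∏ i, a i = 1 → ∀ g : C(Literature.AlgebraicGeometry.Motives.ComplexPoints X, Literature.AlgebraicGeometry.Motives.ComplexPoints X), (∀ x, ∃ t : ℂ, (pt (g x)).rep = t • (a * (pt x).rep)) → Literature.AlgebraicTopology.SingularHomology.singularCohomology.map ℂ ℂ g (2 * 2) c = (∏ i, a i ^ e i) • c; let IsRefl : Fin 6 → Fin 6 → ℂ → C(Literature.AlgebraicGeometry.Motives.ComplexPoints X, Literature.AlgebraicGeometry.Motives.ComplexPoints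 X) → Prop := fun i j ζ g => ∀ x, ∃ t : ℂ, (pt (g x)).rep = t • (fun k => if k = i then ζ * (pt x).rep j else if k = j then ζ⁻¹ * (pt x).rep i else (pt x).rep k); ∀ (σ : Equiv.Perm (Fin 6)) (w : Literature.AlgebraicGeometry.HodgeTheory.complexBetti X (2 * 2)), Literature.AlgebraicGeometry.HodgeTheory.IsRationalClass w → (∃ u v : Literature.AlgebraicGeometry.HodgeTheory.complexBetti X (2 * 2), IsEig (fun i => (![![1, 2, 3, 3, 4, 5], ![1, 2, 2, 3, 5, 5], ![1, 1, 2, 4, 5, 5], ![1, 1, 3, 3, 5, 5]] : Fin 4 → Fin 6 → ℕ) 0 (σ i)) u ∧ IsEig (fun i => 6 - (![![1, 2, 3, 3, 4, 5], ![1, 2, 2, 3, 5, 5], ![1, 1, 2, 4, 5, 5], ![1, 1, 3, 3, 5, 5]] : Fin 4 → Fin 6 → ℕ) 0 (σ i)) v ∧ w = u + v) → w ∈ Submodule.span ℂ {c : Literature.AlgebraicGeometry.HodgeTheory.complexBetti X (2 * 2) | Literature.AlgebraicGeometry.HodgeTheory.IsRationalClass c ∧ Literature.AlgebraicGeometry.HodgeTheory.IsOfHodgeType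 4 X (2 * 2) 2 2 c ∧ ∃ i i' : Fin 6, i ≠ i' ∧ ∃ ζ : ℂ, ζ ^ 6 = 1 ∧ ∃ g : C(Literature.AlgebraicGeometry.Motives.ComplexPoints X, Literature.AlgebraicGeometry.Motives.ComplexPoints X), IsRefl i i' ζ g ∧ Literature.AlgebraicTopology.SingularHomology.singularCohomology.map ℂ ℂ g (2 * 2) c = c} := by
  intro ψ hψ F X pt IsEig IsRefl σ w hw huv
  exact DworkSextic.flatClasses_mem_span_reflInvariant_singleton hψ σ w hw huv

end Summit.HodgeConjecture.HodgeConjecture.Theorems
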